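import Literature.MathematicalPhysics.QuantumFieldTheory.BalabanImbrieJaffe1984to88.BIJ88Eq5410Torus

/-!
# `BalabanImbrieJaffe1984to88.BIJ88Eq5514Torus` — T. Bałaban, J. Imbrie, A. Jaffe, *Effective action and cluster properties of the abelian
Higgs model*, Commun. Math. Phys. **114** (1988) 257–315 [BalabanImbrieJaffe1988], Sect. 5.5 p. 285 [PDF 29]: **(5.5.13)** (the background
field (5.4.6) after the second gauge field translation (5.5.2)) and **(5.5.14)** (its form in `Λ₅^{(k)*}`, by (5.5.11)); Sect. 5.6 p. 285–286
[PDF 29–30]: **(5.6.1)** (the new background field `ũ_{k+1}`), the product formula (5.6.6) `ũ_{k+1}ũ = u′_k`, and the sentence *"In Λ̄₆^{(k)*}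
the A^{(k)} term is absent, and except for scaling, this reduces to the form in the induction hypothesis, (4.2)"* — ON THE TORUS CARRIER OF
RECORD (kind «model instance»), continuing gen 7's (5.4.6) `BIJ88Eq542Torus.eq546_torus`.

statement-level skeleton of published theorems with citation tags; proofs where landed; nothing here is a claim about the Yang–Mills mass gap

PDF held: `paper:balaban1988-cmp114-bij-abelian-higgs-effective-action` (journal page = PDF page + 256); p. 285 [PDF 29] and p. 286 [PDF 30]
rendered and read as images this session (CCITT-G4 ×2, seat folder `renders/original-p029-x2.png`, `renders/original-p030-x2.png`), p. 283
[PDF 27] ((5.5.2)) and p. 282 [PDF 26] ((5.4.6)) = `HOME/lit-balaban-r16/renders/cmp114/original-p027-x2.png`, `original-p026-x2.png`.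

CITATION HEADER (lean-in-tree rule).  Part of the lit-balaban TYPED SKELETON (HOME `run/shared/lean/pub/lit-balaban/`), PHASE-2 proof
seat p31 gen 8 (unit `lit-balaban-p31-g8`; TAKING line HOME/STATUS.md 2026-08-21T18:45Z).  WHAT IS REPRODUCED: rows `C2.Eq5.5.13-5.5.14`
(members (5.5.13), (5.5.14); r16's algebraic core `BIJ88Sect5StatementsPart3.eq5514` over `Module.End`) and `C2.Eq5.6.1-5.6.2` (member
(5.6.1), r16's `uTilde561`; the p. 286 reduction sentence, r16's `uTilde561_of_theta_eq_one`) of `HOME/lit-balaban-r16/ROWS-C2-part2.md`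
(owner r16), and member (5.6.6) of row `C2.Eq5.6.6-5.6.12` (r16's `eq566`) — each at the torus level of gen 6/7's (5.3.3)/(5.4.2)/(5.4.6)
(`BIJ88Eq533Torus`, `BIJ88Eq542Torus`).

THE PRINTED TEXT (verbatim).  p. 283: *"The translation we actually use is localized, and is given by A′ = A^{(k)} − Λ₄^{(k)*}L^{−2}C^{(k)}_{loc}
H*_{k,loc}∂*Q^{e*}_{k+1}f. (5.5.2)"*.  p. 285: *"After the translation, the background gauge field looks as follows. For b ∈ Λ̄₃^{(k)c*c},
(5.4.6) becomes u′_k = (Q^{s*}_{k+1}v) exp ie_kη[(w₁ + H_{k,loc})(A^{(k)} − Λ₄^{(k)*}L^{−2}C^{(k)}_{loc}H*_{k,loc}∂*Q^{e*}_{k+1}f) + ∂Λ̄₃^{(k)c}C_k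
□A^{(k)} − L^{−2}𝒟_{k,loc}∂*Q^{e*}_{k+1}f]. (5.5.13) In Λ₅^{(k)*} we apply (5.5.11) to obtain u′_k = (Q^{s*}_{k+1}v) exp ie_kη[H_{k,loc}A^{(k)} −
L^{−2}𝒟^η_{k+1,loc}∂*Q^{e*}_{k+1}f + w₁A′]. (5.5.14) The same formula holds in Λ̄₅^{(k)*} for the gauge field in the normalization factors, except
that we have w₅ instead of w₁. 5.6. … Let θ_k be a function on T*_η that equals 1 in Λ̄₆^{(k)*}, 0 in Λ̄₅^{(k)*c}, and changes smoothly from 0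
to 1 in a neighborhood of Λ̄₆^{(k)*} of thickness M = O(1). … The new background field for the action and observables is denoted ũ_{k+1}, and
for b ∈ Λ̄₅^{(k)*} it is given by ũ_{k+1} = (Q^{s*}_{k+1}v) exp ie_kη[(1 − θ_k)H_{k,loc}A^{(k)} − L^{−2}𝒟^η_{k+1,loc}∂*Q^{e*}_{k+1}f]. (5.6.1)"*.
p. 286: *"In Λ̄₆^{(k)*} the A^{(k)} term is absent, and except for scaling, this reduces to the form in the induction hypothesis, (4.2). To
summarize all the changes we have made on the background field, the final form of ũ_{k+1} is given by (5.3.3) in Λ̄₆^{(k−1)*} ∩ Λ̄₃^{(k)c}, by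
(5.5.13) in Λ̄₃^{(k)c*c} ∩ Λ̄₅^{(k)*c} (but without the w₁ terms), and by (5.6.1) in Λ̄₅^{(k)*}."*.  p. 287: *"ũ_{k+1}ũ = ũ_{k+1} exp ie_kη
[θ_kH_{k,loc}A^{(k)} + w₁A′] = ũ_{k+1}e^{ie_kηÃ}. (5.6.6)"*.  (5.5.11) p. 285: *"𝒟_{k,loc} + H_{k,loc}C^{(k)}_{loc}H*_{k,loc} = 𝒟^η_{k+1,loc}"*.

WHAT THESE ARE, and what is data.  (5.5.13) IS gen 7's (5.4.6) `eq546_torus` — the `bgGaugeU`-transformed ((5.4.5), gauge function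
`Λ̄₃·C_k(□A′)`) translated background field `u_k` of (5.3.3)/(5.4.2), equal on `□₀ ∩ Λ̄₁^{(k)*}` to `(Q^{s*}_{k+1}v) exp ie_kη[H_{k,loc}A′ + ∂(Λ̄₃ᶜ·
C_k□A′) + w₁A′ − L^{−2}𝒟_{k,loc}∂*Q^{e*}_{k+1}f]` — with the CHANGE OF VARIABLES (5.5.2) `A′ = A^{(k)} − L^{−2}V` performed in it; the translation
vector `V` (a unit-lattice bond function) is kept GENERAL: print has `V = Λ₄^{(k)*}C^{(k)}_{loc}H*_{k,loc}∂*Q^{e*}_{k+1}f` (cut-off OUTSIDE `C_{loc}`),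
the owner-ruled repair of HOME/GAPS.md G-C2-08 (reading (a), r16 gen 4) has `V = C^{(k)}_{loc}Λ₄^{(k)*}H*_{k,loc}∂*Q^{e*}_{k+1}f` (cut-off INSIDE) —
both are instances (§3).  The operator `𝒟_{k,loc}∂*Q^{e*}_k` of gen 6/7 (`T_loc`) is here FACTORED as `𝒟_{k,loc} ∘ S`, `S = ∂*Q^{e*}_k` (η-bond
functions ← unit-lattice plaquette functions), so that the η-bond function `X_f := S(Q^{e*}f) = ∂*Q^{e*}_{k+1}f` (`Q^{e*}_kQ^{e*} = Q^{e*}_{k+1}`,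
gen 2's `BIJ85Eq224ProofPart2.QestarIter_succ`) is the common argument of the translation (5.5.2), of the `f`-term, and of (5.5.11).  (5.5.14)
then needs, at the bond `b ∈ Λ₅^{(k)*}` considered, exactly three things: `b ∈ Λ̄₃^{(k)*}` (so the gauge term `∂(Λ̄₃ᶜ·λ)` vanishes at `b`:
`grad_indicator_compl_of_mem_starB`), *"Λ₄^{(k)*} acts as the identity"* under `H_{k,loc}` at `b` (hypothesis `hΛ₄`: `(H_{k,loc}V)(b) =
(H_{k,loc}C_{loc}H*_{loc}X_f)(b)`, DERIVED in §3 from a range relation for `H_{k,loc}` (printed order) or for `H_{k,loc}C_{loc}` (repaired order)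
by gen 7's `apply_indicator_eq_of_range`), and (5.5.11) as the displayed operator hypothesis `h5511 : 𝒟_{k,loc} + H_{k,loc}C_{loc}H*_{loc} =
𝒟^η_{k+1,loc}` (linear maps on η-bond functions; r16's `eq5511` proves it in the (2.12) bookkeeping `curlyDloc`, `eq5514` is the same algebra
over one `Module.End` ring — the torus operators act between DIFFERENT lattices, so the three-line algebra is re-done here on functions).
(5.6.1)/(5.6.6): with `Q = Q^{s*}_{k+1}v` (the concrete `(k+1)`-fold group-valued pull-back `qsstarGIter (k+1) v` read in `ℂ`), `HA = H_{k,loc}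
A^{(k)}`, `DXf = 𝒟^η_{k+1,loc}X_f`, r16's `uTilde561`/`uSmall566` are the torus fields and (5.6.6) `ũ_{k+1}·ũ = u′_k` holds at `b` by r16's
`eq566`; where `θ_k = 1` (on `Λ̄₆^{(k)*}`, r16's `IsTheta561`) `ũ_{k+1}` IS r18's (4.2) `backgroundU e_k η (Q^{s*}_{k+1}v) (L^{−2}DXf)` — the
induction-hypothesis form with the block field pulled back `k+1` times (the rescaling to `T^{(k+1)}_1`, (5.15.3), is not performed here).
Data, exactly as in gen 7: `T_k = 𝒟_k∂*Q^{e*}_k`, `H_k`, `H_{k,loc}`, `C_k`, `Q^{e*} = Qes` (linear maps), NEW data `𝒟_{k,loc}`, `S = ∂*Q^{e*}_k`,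
`C^{(k)}_{loc}`, `H*_{k,loc}`, `𝒟^η_{k+1,loc}` (linear maps), `θ_k` (a real η-bond function); CONCRETE: `Q^{s*}_k` = `(torusBlockBondsIter P i
k).Qsstar`, `Q^{s*}_{k+1}v = qsstarGIter (k+1) v`, `∂ = curl 1`, `∂^η = grad η⁻¹`, the translated field `u = u′·(Λ₁′*Q^{s*}v)` with `u′ =
e^{ie_kA′}` on `Λ₁^{(k)*}`, `A′ = A^{(k)} − L^{−2}V`; hypotheses `h541` ((5.4.1) = (2.20), discharged at base 0 by gen 7's `BIJ88Eq541Base0`),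
`hT` (the (5.3.4) locality), `hdep` (the p. 281 range sentence, discharged in metric form by `BIJ88Eq5410Torus.apply_curl_indicator_eq_of_supDist`).

READING NOTE (recorded in HOME/GAPS.md by this seat, owner r16 to rule).  Substituting (5.5.2) into (5.4.6) gives the gauge term
`∂Λ̄₃^{(k)c}C_k□A′`, `A′ = A^{(k)} − L^{−2}V`; print (5.5.13) has `∂Λ̄₃^{(k)c}C_k□A^{(k)}`.  The two differ by `L^{−2}∂(Λ̄₃ᶜ·C_k□V)`, which is
nonzero only on bonds with an endpoint outside `Λ̄₃^{(k)}` (`grad_indicator_compl_of_mem_starB`) and vanishes identically wherever (5.5.14) ∕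
(5.6.1) are used (`Λ₅^{(k)*} ⊂ Λ̄₃^{(k)*}`); `eq5513_torus` states the substituted form, `eq5513_printed_of_mem_starB` the printed form on `Λ̄₃^{(k)*}`.

CARRIERS (all of record): η-lattice = torus level `i`, unit lattice `T₁^{(k)}` = level `i + k`, block lattice = level `i + k + 1` (standing
range `i + k + 1 ≤ m + K`); U(1) fields read in `ℂ` by `toC`; r18's `backgroundU` ((4.2)) / `bgGaugeU` ((4.16) = (5.4.5)); r16's `bgExp`,
`uTilde561`, `uSmall566`, `IsTheta561`; gen 6's `blockUnion`, `starB` (p. 266).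

WHAT IS PROVED (theorems only; 0 `sorry`, standard axioms, no `def`, no `Prop`-valued fact introduced).
* §0 `grad_indicator_compl_of_mem_starB` (`∂^η(Λ̄₃ᶜ·λ) = 0` on `Λ̄₃*`), `grad_indicator_compl_sub` (the reading-note difference term).
* §1 **`eq5513_torus`** ((5.5.13) on `□₀ ∩ Λ̄₁^{(k)*}`, general translation vector `V`), `eq5513_printed_of_mem_starB` (print's `C_k□A^{(k)}` form
  on `Λ̄₃^{(k)*}`).
* §2 **`eq5514_torus`** ((5.5.14): on `b ∈ □₀ ∩ Λ̄₁* ∩ Λ̄₃*` with `hΛ₄`, `h5511`: the field is `(Q^{s*}_{k+1}v) exp ie_kη[H_{k,loc}A^{(k)} −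
  L^{−2}𝒟^η_{k+1,loc}X_f + w₁A′]`, `w₁A′ = (T_k − 𝒟_{k,loc}S)∂(□A′) + H_k(□A′) − H_{k,loc}A′` as in gen 7).
* §3 the hypothesis `hΛ₄` from range relations: `cutoff4_invisible_printed` (`V = Λ₄*·C_{loc}H*_{loc}X_f`, range of `H_{k,loc}` inside `Λ₄*` at `b`),
  `cutoff4_invisible_repaired` (`V = C_{loc}(Λ₄*·H*_{loc}X_f)`, range of `H_{k,loc}C_{loc}`), `h5511_apply` (the pointwise form of (5.5.11)); in the
  torus `ℓ^∞` distance `supDist`: `starB_of_collar` (a cube of radius `N ≥ N₀ + R + 1` about `x₀` contains in its bond star every bond within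
  range `R` of the cube of radius `N₀`), **`cutoff4_invisible_supDist`** (`hΛ₄` for an `H_{k,loc}` of `ℓ^∞` range `R`, `Λ₅ + (R+1)`-collar `⊆ Λ₄`).
* §4 **`eq566_torus`** ((5.6.6)/(5.6.1): the same field `= ũ_{k+1}(b)·ũ(b)` with r16's `uTilde561`/`uSmall566`, any `θ_k`),
  **`uTilde561_eq_backgroundU_of_mem`** (on `Λ̄₆^{(k)*}`, `θ_k = 1`: `ũ_{k+1} = backgroundU e_k η (Q^{s*}_{k+1}v) (L^{−2}𝒟^η_{k+1,loc}X_f)`, r18's (4.2)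
  form with the `(k+1)`-fold pull-back), `uTilde561_eq_of_not_mem` (off `Λ̄₅^{(k)*}`, `θ_k = 0`: the full `H_{k,loc}A^{(k)}` term, i.e. (5.5.14)
  without `w₁A′` — the p. 286 summary's middle region).
HONEST SCOPE.  Not here: any bound (`w₁`, `w₅`, (5.4.7), (5.5.5)), the smoothness clause of `θ_k`, the specific radii of `Λ₃ ⊃ Λ₄ ⊃ Λ₅ ⊃ Λ₆`
(they enter as the membership ∕ range hypotheses named above), (5.5.11) for concrete kernels (hypothesis `h5511`), the `w₅` variant for the
normalization factors (same algebra with gen 7's `BIJ88Eq5410Torus.eq5410_torus`; not spelled out), the rescaling (5.15.3).  Import: gen 7's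
`BIJ88Eq5410Torus` (→ `BIJ88Eq542Torus` → gen 6's `BIJ88Eq564Torus`/`BIJ88Eq533Torus`).  Unit `lit-balaban-p31` (literature-prover-lit-balaban-p31-g8-0),
2026-08-21.
-/

namespace Literature.MathematicalPhysics.QuantumFieldTheory.BalabanImbrieJaffe1984to88.BIJ88Eq5514Torus

open Literature.MathematicalPhysics.QuantumFieldTheory.Balaban1983to89
open BIJ88Sect3Statements (U1 toC starB mem_starB starP)
open BIJ88Sect4Statements (backgroundU bgGaugeU)
open BIJ88Sect5StatementsPart3 (bgExp uTilde561 uSmall566 bracket561 IsTheta561 eq566 uTilde561_of_theta_eq_one)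
open BIJ85BlockAveragesTorus (expU1 surfMul)
open BIJ85Eq453GaugeField (qsstarGIter)
open BIJ85Eq224Proof (torusBlockBondsIter)
open BIJ88Eq536Linearization (cutoff)
open BIJ88Eq533Torus (blockUnion)
open BIJ88Eq542Torus (eq546_torus apply_indicator_eq_of_range)
open LatticeFieldCalculus (grad curl supDist)
open BIJ85Ineq722Torus (supDist_triangle supDist_runSite_le)
open scoped BigOperators Real
open Complex Finset

noncomputable section

variable {P : Params} {i : ℕ}

/-! ## §0 The gauge term `∂Λ̄₃^{(k)c}C_k□A′` vanishes on `Λ̄₃^{(k)*}` -/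

/-- kernel: **the η-gradient of a site function supported outside `Λ̄₃` vanishes on the bonds of `Λ̄₃*`**: for `b ∈ S*` (both endpoints in `S`),
`∂^η(Sᶜ·λ)(b) = 0` (any constant `c`) — why the term `∂Λ̄₃^{(k)c}C_k□A^{(k)}` of (5.5.13) is absent from (5.5.14)/(5.6.1) in `Λ₅^{(k)*} ⊂ Λ̄₃^{(k)*}`.
[cite: BalabanImbrieJaffe1988, (5.5.14) p.285] -/
theorem grad_indicator_compl_of_mem_starB {n : ℕ} (c : ℝ) (S : Finset (Balaban1983to89.Site P n)) (lam : Balaban1983to89.Site P n → ℝ)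
    {b : PBond P n} (hb : b ∈ starB S) : grad c ((↑Sᶜ : Set (Balaban1983to89.Site P n)).indicator lam) b = 0 := by
  obtain ⟨h1, h2⟩ := (mem_starB S b).1 hb
  have e1 : (↑Sᶜ : Set (Balaban1983to89.Site P n)).indicator lam b.src = 0 :=
    Set.indicator_of_notMem (fun h => (Finset.mem_compl.1 (Finset.mem_coe.1 h)) h1) lam
  have e2 : (↑Sᶜ : Set (Balaban1983to89.Site P n)).indicator lam b.tgt = 0 :=
    Set.indicator_of_notMem (fun h => (Finset.mem_compl.1 (Finset.mem_coe.1 h)) h2) lam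
  simp only [grad, e1, e2, sub_self, smul_zero]

/-- kernel (the READING NOTE's difference term): for a linear `C_k`, `∂^η(Sᶜ·C_k(□(A − L^{−2}V))) = ∂^η(Sᶜ·C_k(□A)) − L^{−2}∂^η(Sᶜ·C_k(□V))` at
every bond — the substituted gauge term of (5.5.13) minus the printed one is `−L^{−2}∂(Λ̄₃ᶜ·C_k□V)`. [cite: BalabanImbrieJaffe1988, (5.5.13) p.285] -/
theorem grad_indicator_compl_sub {n m : ℕ} (c L : ℝ) (S : Finset (Balaban1983to89.Site P n))
    (Ck : (PBond P m → ℝ) →ₗ[ℝ] (Balaban1983to89.Site P n → ℝ)) (Bx : Finset (PBond P m)) (A V : PBond P m → ℝ) (b : PBond P n) :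
    grad c ((↑Sᶜ : Set (Balaban1983to89.Site P n)).indicator (Ck ((↑Bx : Set (PBond P m)).indicator (A - L⁻¹ ^ 2 • V)))) b =
      grad c ((↑Sᶜ : Set (Balaban1983to89.Site P n)).indicator (Ck ((↑Bx : Set (PBond P m)).indicator A))) b -
        L⁻¹ ^ 2 * grad c ((↑Sᶜ : Set (Balaban1983to89.Site P n)).indicator (Ck ((↑Bx : Set (PBond P m)).indicator V))) b := by
  have hind : (↑Bx : Set (PBond P m)).indicator (A - L⁻¹ ^ 2 • V) =
      (↑Bx : Set (PBond P m)).indicator A - L⁻¹ ^ 2 • (↑Bx : Set (PBond P m)).indicator V := by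
    funext x
    simp only [Set.indicator_apply, Pi.sub_apply, Pi.smul_apply, smul_eq_mul]
    split_ifs <;> ring
  have hS : ∀ x, (↑Sᶜ : Set (Balaban1983to89.Site P n)).indicator (Ck ((↑Bx : Set (PBond P m)).indicator (A - L⁻¹ ^ 2 • V))) x =
      (↑Sᶜ : Set (Balaban1983to89.Site P n)).indicator (Ck ((↑Bx : Set (PBond P m)).indicator A)) x -
        L⁻¹ ^ 2 * (↑Sᶜ : Set (Balaban1983to89.Site P n)).indicator (Ck ((↑Bx : Set (PBond P m)).indicator V)) x := by
    intro x
    rw [hind, map_sub, map_smul]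
    simp only [Set.indicator_apply, Pi.sub_apply, Pi.smul_apply, smul_eq_mul]
    split_ifs <;> ring
  simp only [grad, hS, smul_eq_mul]
  ring

/-! ## §1 (5.5.13) on the torus: the change of variables (5.5.2) in (5.4.6) -/

/-- **(5.5.13) ON THE TORUS.**  p. 285 [PDF 29], verbatim: *"After the translation, the background gauge field looks as follows. For b ∈
Λ̄₃^{(k)c*c}, (5.4.6) becomes u′_k = (Q^{s*}_{k+1}v) exp ie_kη[(w₁ + H_{k,loc})(A^{(k)} − Λ₄^{(k)*}L^{−2}C^{(k)}_{loc}H*_{k,loc}∂*Q^{e*}_{k+1}f) +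
∂Λ̄₃^{(k)c}C_k□A^{(k)} − L^{−2}𝒟_{k,loc}∂*Q^{e*}_{k+1}f]. (5.5.13)"*  HERE: the setting of gen 7's (5.4.6) `BIJ88Eq542Torus.eq546_torus` (the
`bgGaugeU`-transform, gauge function `Λ̄₃·C_k(□A′)`, of the translated background field `u_k`; bond `b ∈ □₀ ∩ Λ̄₁^{(k)*}`; hypotheses `h541` =
(5.4.1), `hT` = the (5.3.4) locality, `hdep` = the p. 281 range sentence) with `T_loc = 𝒟_{k,loc} ∘ S` (`S = ∂*Q^{e*}_k`) and THE CHANGE OF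
VARIABLES (5.5.2) `A′ = A^{(k)} − L^{−2}V` for a general unit-lattice bond function `V` (print: `V = Λ₄^{(k)*}C^{(k)}_{loc}H*_{k,loc}∂*Q^{e*}_{k+1}f`).
CONCLUSION: the field at `b` is `(Q^{s*}_{k+1}v)(b) · exp ie_kη[(w₁ + H_{k,loc})(A^{(k)} − L^{−2}V) + ∂(Λ̄₃ᶜ·C_k□(A^{(k)} − L^{−2}V)) − L^{−2}𝒟_{k,loc}
S(Q^{e*}f)](b)`, `w₁A′ = (T_k − 𝒟_{k,loc}S)∂(□A′) + H_k(□A′) − H_{k,loc}A′` spelled out (standing range; gauge term with `□A′`, see the module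
READING NOTE and `eq5513_printed_of_mem_starB`). [cite: BalabanImbrieJaffe1988, (5.5.13) p.285] -/
theorem eq5513_torus {k : ℕ} (hk : i + k + 1 ≤ P.m + P.K) {ek η : ℝ} (hη : η * (P.L : ℝ) ^ k = 1)
    (X : Finset (Balaban1983to89.Site P (i + k + 1))) {u' : GaugeField P (i + k) U1} (A V : PBond P (i + k) → ℝ) (L : ℝ)
    (hu : ∀ c ∈ starB (blockUnion 1 X), u' c = expU1 (ek * (A - L⁻¹ ^ 2 • V) c)) (v : GaugeField P (i + k + 1) U1) (g : PBond P i → ℝ)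
    {Plc : Type*} (Tk : (Balaban1983to89.Plaq P (i + k) → ℝ) →ₗ[ℝ] (PBond P i → ℝ))
    (Dloc : (PBond P i → ℝ) →ₗ[ℝ] (PBond P i → ℝ)) (S : (Balaban1983to89.Plaq P (i + k) → ℝ) →ₗ[ℝ] (PBond P i → ℝ))
    (Hk Hloc : (PBond P (i + k) → ℝ) →ₗ[ℝ] (PBond P i → ℝ)) (Ck : (PBond P (i + k) → ℝ) →ₗ[ℝ] (Balaban1983to89.Site P i → ℝ))
    (h541 : ∀ (B : PBond P (i + k) → ℝ) (b : PBond P i),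
      (torusBlockBondsIter P i k).Qsstar B b - Tk (curl 1 B) b = Hk B b + grad η⁻¹ (Ck B) b)
    (Qes : (Plc → ℝ) →ₗ[ℝ] (Balaban1983to89.Plaq P (i + k) → ℝ)) (f : Plc → ℝ)
    (Xb X₀ : Finset (Balaban1983to89.Site P (i + k))) (hX₀ : X₀ ⊆ Xb) (S₃ : Finset (Balaban1983to89.Site P i))
    {b : PBond P i} (hb₁ : b ∈ starB (blockUnion (k + 1) X)) (hb₀ : b ∈ starB (blockUnion k X₀))
    (hT : g b = Dloc (S (curl 1 (A - L⁻¹ ^ 2 • V) + L⁻¹ ^ 2 • Qes f)) b)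
    (hdep : ∀ F₁ F₂ : Balaban1983to89.Plaq P (i + k) → ℝ, (∀ p ∈ starP Xb, F₁ p = F₂ p) → Dloc (S F₁) b = Dloc (S F₂) b) :
    bgGaugeU ek η ((↑S₃ : Set (Balaban1983to89.Site P i)).indicator
        (Ck ((↑(starB Xb) : Set (PBond P (i + k))).indicator (A - L⁻¹ ^ 2 • V))))
        (backgroundU ek η (fun b => toC (qsstarGIter k (surfMul u' (cutoff (starB X) v)) b)) g) b =
      bgExp ek η (fun b => toC (qsstarGIter (k + 1) v b))
        (fun b =>
          (((Tk (curl 1 ((↑(starB Xb) : Set (PBond P (i + k))).indicator (A - L⁻¹ ^ 2 • V))) b -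
                Dloc (S (curl 1 ((↑(starB Xb) : Set (PBond P (i + k))).indicator (A - L⁻¹ ^ 2 • V)))) b) +
              (Hk ((↑(starB Xb) : Set (PBond P (i + k))).indicator (A - L⁻¹ ^ 2 • V)) b - Hloc (A - L⁻¹ ^ 2 • V) b)) +
            Hloc (A - L⁻¹ ^ 2 • V) b) +
          grad η⁻¹ ((↑S₃ᶜ : Set (Balaban1983to89.Site P i)).indicator
            (Ck ((↑(starB Xb) : Set (PBond P (i + k))).indicator (A - L⁻¹ ^ 2 • V)))) b -
          L⁻¹ ^ 2 * Dloc (S (Qes f)) b) b := by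
  -- (5.4.6) with `T_loc = 𝒟_{k,loc} ∘ S` and `A′ = A − L⁻²V`
  have h546 := eq546_torus hk hη X hu v g L Tk (Dloc ∘ₗ S) Hk Hloc Ck h541 Qes f Xb X₀ hX₀ S₃ hb₁ hb₀
    (by simpa only [LinearMap.coe_comp, Function.comp_apply] using hT)
    (fun F₁ F₂ h => by simpa only [LinearMap.coe_comp, Function.comp_apply] using hdep F₁ F₂ h)
  rw [h546]
  simp only [bgExp, LinearMap.coe_comp, Function.comp_apply]
  congr 1
  congr 1
  push_cast
  ring

/-- **(5.5.13), the printed gauge term on `Λ̄₃^{(k)*}`.**  Print has `∂Λ̄₃^{(k)c}C_k□A^{(k)}` where the substitution gives `∂Λ̄₃^{(k)c}C_k□A′`; on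
a bond of `Λ̄₃^{(k)*}` BOTH vanish (`grad_indicator_compl_of_mem_starB`), so there (in particular in `Λ₅^{(k)*}`, where (5.5.13) is used for
(5.5.14)) the field equals the printed right side verbatim: under the hypotheses of `eq5513_torus` and `b ∈ S₃*`, the field at `b` is
`(Q^{s*}_{k+1}v)(b) · exp ie_kη[(w₁ + H_{k,loc})(A^{(k)} − L^{−2}V) + ∂(Λ̄₃ᶜ·C_k□A^{(k)}) − L^{−2}𝒟_{k,loc}S(Q^{e*}f)](b)` (standing range).
[cite: BalabanImbrieJaffe1988, (5.5.13) p.285] -/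
theorem eq5513_printed_of_mem_starB {k : ℕ} (hk : i + k + 1 ≤ P.m + P.K) {ek η : ℝ} (hη : η * (P.L : ℝ) ^ k = 1)
    (X : Finset (Balaban1983to89.Site P (i + k + 1))) {u' : GaugeField P (i + k) U1} (A V : PBond P (i + k) → ℝ) (L : ℝ)
    (hu : ∀ c ∈ starB (blockUnion 1 X), u' c = expU1 (ek * (A - L⁻¹ ^ 2 • V) c)) (v : GaugeField P (i + k + 1) U1) (g : PBond P i → ℝ)
    {Plc : Type*} (Tk : (Balaban1983to89.Plaq P (i + k) → ℝ) →ₗ[ℝ] (PBond P i → ℝ))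
    (Dloc : (PBond P i → ℝ) →ₗ[ℝ] (PBond P i → ℝ)) (S : (Balaban1983to89.Plaq P (i + k) → ℝ) →ₗ[ℝ] (PBond P i → ℝ))
    (Hk Hloc : (PBond P (i + k) → ℝ) →ₗ[ℝ] (PBond P i → ℝ)) (Ck : (PBond P (i + k) → ℝ) →ₗ[ℝ] (Balaban1983to89.Site P i → ℝ))
    (h541 : ∀ (B : PBond P (i + k) → ℝ) (b : PBond P i),
      (torusBlockBondsIter P i k).Qsstar B b - Tk (curl 1 B) b = Hk B b + grad η⁻¹ (Ck B) b)
    (Qes : (Plc → ℝ) →ₗ[ℝ] (Balaban1983to89.Plaq P (i + k) → ℝ)) (f : Plc → ℝ)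
    (Xb X₀ : Finset (Balaban1983to89.Site P (i + k))) (hX₀ : X₀ ⊆ Xb) (S₃ : Finset (Balaban1983to89.Site P i))
    {b : PBond P i} (hb₁ : b ∈ starB (blockUnion (k + 1) X)) (hb₀ : b ∈ starB (blockUnion k X₀)) (hb₃ : b ∈ starB S₃)
    (hT : g b = Dloc (S (curl 1 (A - L⁻¹ ^ 2 • V) + L⁻¹ ^ 2 • Qes f)) b)
    (hdep : ∀ F₁ F₂ : Balaban1983to89.Plaq P (i + k) → ℝ, (∀ p ∈ starP Xb, F₁ p = F₂ p) → Dloc (S F₁) b = Dloc (S F₂) b) :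
    bgGaugeU ek η ((↑S₃ : Set (Balaban1983to89.Site P i)).indicator
        (Ck ((↑(starB Xb) : Set (PBond P (i + k))).indicator (A - L⁻¹ ^ 2 • V))))
        (backgroundU ek η (fun b => toC (qsstarGIter k (surfMul u' (cutoff (starB X) v)) b)) g) b =
      bgExp ek η (fun b => toC (qsstarGIter (k + 1) v b))
        (fun b =>
          (((Tk (curl 1 ((↑(starB Xb) : Set (PBond P (i + k))).indicator (A - L⁻¹ ^ 2 • V))) b -
                Dloc (S (curl 1 ((↑(starB Xb) : Set (PBond P (i + k))).indicator (A - L⁻¹ ^ 2 • V)))) b) +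
              (Hk ((↑(starB Xb) : Set (PBond P (i + k))).indicator (A - L⁻¹ ^ 2 • V)) b - Hloc (A - L⁻¹ ^ 2 • V) b)) +
            Hloc (A - L⁻¹ ^ 2 • V) b) +
          grad η⁻¹ ((↑S₃ᶜ : Set (Balaban1983to89.Site P i)).indicator
            (Ck ((↑(starB Xb) : Set (PBond P (i + k))).indicator A))) b -
          L⁻¹ ^ 2 * Dloc (S (Qes f)) b) b := by
  rw [eq5513_torus hk hη X A V L hu v g Tk Dloc S Hk Hloc Ck h541 Qes f Xb X₀ hX₀ S₃ hb₁ hb₀ hT hdep]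
  simp only [bgExp]
  rw [grad_indicator_compl_of_mem_starB η⁻¹ S₃ _ hb₃, grad_indicator_compl_of_mem_starB η⁻¹ S₃ _ hb₃]

/-! ## §2 (5.5.14) on the torus: *"In Λ₅^{(k)*} we apply (5.5.11)"* -/

/-- kernel: **(5.5.11) applied to a bond function** — from the operator identity `𝒟_{k,loc} + H_{k,loc}C^{(k)}_{loc}H*_{k,loc} = 𝒟^η_{k+1,loc}`
(hypothesis, on η-bond functions) its value at `(X_f, b)`. [cite: BalabanImbrieJaffe1988, (5.5.11) p.285] -/
theorem h5511_apply {m n : ℕ} (Dloc Dnext : (PBond P n → ℝ) →ₗ[ℝ] (PBond P n → ℝ))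
    (Hloc : (PBond P m → ℝ) →ₗ[ℝ] (PBond P n → ℝ)) (Cloc : (PBond P m → ℝ) →ₗ[ℝ] (PBond P m → ℝ))
    (Hsloc : (PBond P n → ℝ) →ₗ[ℝ] (PBond P m → ℝ)) (h5511 : Dloc + Hloc ∘ₗ Cloc ∘ₗ Hsloc = Dnext) (Xf : PBond P n → ℝ) (b : PBond P n) :
    Dloc Xf b + Hloc (Cloc (Hsloc Xf)) b = Dnext Xf b := by
  have h := congrArg (fun T : (PBond P n → ℝ) →ₗ[ℝ] (PBond P n → ℝ) => T Xf b) h5511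
  simpa only [LinearMap.add_apply, LinearMap.coe_comp, Function.comp_apply, Pi.add_apply] using h

/-- **(5.5.14) ON THE TORUS.**  p. 285 [PDF 29], verbatim: *"In Λ₅^{(k)*} we apply (5.5.11) to obtain u′_k = (Q^{s*}_{k+1}v) exp ie_kη[H_{k,loc}
A^{(k)} − L^{−2}𝒟^η_{k+1,loc}∂*Q^{e*}_{k+1}f + w₁A′]. (5.5.14)"*  HERE: the setting of `eq5513_torus` (translation vector `V`, `X_f := S(Q^{e*}f) =
∂*Q^{e*}_{k+1}f`), at a bond `b` which moreover lies in `Λ̄₃^{(k)*}` (`hb₃`: the gauge term vanishes — `Λ₅^{(k)*} ⊂ Λ̄₃^{(k)*}`), at which *"Λ₄^{(k)*}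
acts as the identity"* under `H_{k,loc}` (`hΛ₄ : (H_{k,loc}V)(b) = (H_{k,loc}C^{(k)}_{loc}H*_{k,loc}X_f)(b)`, from a range relation by
`cutoff4_invisible_printed`/`_repaired`, §3), and with (5.5.11) as the displayed operator hypothesis `h5511 : 𝒟_{k,loc} + H_{k,loc}C^{(k)}_{loc}
H*_{k,loc} = 𝒟^η_{k+1,loc}`.  CONCLUSION: the field at `b` is `(Q^{s*}_{k+1}v)(b) · exp ie_kη[H_{k,loc}A^{(k)} − L^{−2}𝒟^η_{k+1,loc}X_f + w₁A′](b)`,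
`w₁A′ = (T_k − 𝒟_{k,loc}S)∂(□A′) + H_k(□A′) − H_{k,loc}A′`, `A′ = A^{(k)} − L^{−2}V` (standing range; r16's `eq5514` is this algebra over one
`Module.End` ring with `Λ₄ = 1`). [cite: BalabanImbrieJaffe1988, (5.5.14) p.285] -/
theorem eq5514_torus {k : ℕ} (hk : i + k + 1 ≤ P.m + P.K) {ek η : ℝ} (hη : η * (P.L : ℝ) ^ k = 1)
    (X : Finset (Balaban1983to89.Site P (i + k + 1))) {u' : GaugeField P (i + k) U1} (A V : PBond P (i + k) → ℝ) (L : ℝ)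
    (hu : ∀ c ∈ starB (blockUnion 1 X), u' c = expU1 (ek * (A - L⁻¹ ^ 2 • V) c)) (v : GaugeField P (i + k + 1) U1) (g : PBond P i → ℝ)
    {Plc : Type*} (Tk : (Balaban1983to89.Plaq P (i + k) → ℝ) →ₗ[ℝ] (PBond P i → ℝ))
    (Dloc Dnext : (PBond P i → ℝ) →ₗ[ℝ] (PBond P i → ℝ)) (S : (Balaban1983to89.Plaq P (i + k) → ℝ) →ₗ[ℝ] (PBond P i → ℝ))
    (Hk Hloc : (PBond P (i + k) → ℝ) →ₗ[ℝ] (PBond P i → ℝ)) (Ck : (PBond P (i + k) → ℝ) →ₗ[ℝ] (Balaban1983to89.Site P i → ℝ))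
    (Cloc : (PBond P (i + k) → ℝ) →ₗ[ℝ] (PBond P (i + k) → ℝ)) (Hsloc : (PBond P i → ℝ) →ₗ[ℝ] (PBond P (i + k) → ℝ))
    (h541 : ∀ (B : PBond P (i + k) → ℝ) (b : PBond P i),
      (torusBlockBondsIter P i k).Qsstar B b - Tk (curl 1 B) b = Hk B b + grad η⁻¹ (Ck B) b)
    (h5511 : Dloc + Hloc ∘ₗ Cloc ∘ₗ Hsloc = Dnext)
    (Qes : (Plc → ℝ) →ₗ[ℝ] (Balaban1983to89.Plaq P (i + k) → ℝ)) (f : Plc → ℝ)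
    (Xb X₀ : Finset (Balaban1983to89.Site P (i + k))) (hX₀ : X₀ ⊆ Xb) (S₃ : Finset (Balaban1983to89.Site P i))
    {b : PBond P i} (hb₁ : b ∈ starB (blockUnion (k + 1) X)) (hb₀ : b ∈ starB (blockUnion k X₀)) (hb₃ : b ∈ starB S₃)
    (hT : g b = Dloc (S (curl 1 (A - L⁻¹ ^ 2 • V) + L⁻¹ ^ 2 • Qes f)) b)
    (hdep : ∀ F₁ F₂ : Balaban1983to89.Plaq P (i + k) → ℝ, (∀ p ∈ starP Xb, F₁ p = F₂ p) → Dloc (S F₁) b = Dloc (S F₂) b)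
    (hΛ₄ : Hloc V b = Hloc (Cloc (Hsloc (S (Qes f)))) b) :
    bgGaugeU ek η ((↑S₃ : Set (Balaban1983to89.Site P i)).indicator
        (Ck ((↑(starB Xb) : Set (PBond P (i + k))).indicator (A - L⁻¹ ^ 2 • V))))
        (backgroundU ek η (fun b => toC (qsstarGIter k (surfMul u' (cutoff (starB X) v)) b)) g) b =
      bgExp ek η (fun b => toC (qsstarGIter (k + 1) v b))
        (fun b => Hloc A b - L⁻¹ ^ 2 * Dnext (S (Qes f)) b +
          ((Tk (curl 1 ((↑(starB Xb) : Set (PBond P (i + k))).indicator (A - L⁻¹ ^ 2 • V))) b -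
              Dloc (S (curl 1 ((↑(starB Xb) : Set (PBond P (i + k))).indicator (A - L⁻¹ ^ 2 • V)))) b) +
            (Hk ((↑(starB Xb) : Set (PBond P (i + k))).indicator (A - L⁻¹ ^ 2 • V)) b - Hloc (A - L⁻¹ ^ 2 • V) b))) b := by
  rw [eq5513_torus hk hη X A V L hu v g Tk Dloc S Hk Hloc Ck h541 Qes f Xb X₀ hX₀ S₃ hb₁ hb₀ hT hdep]
  -- the gauge term vanishes at `b ∈ Λ̄₃*`, `H_loc A′ = H_loc A − L⁻² H_loc V`, `Λ₄*` invisible at `b`, then (5.5.11)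
  have hgrad := grad_indicator_compl_of_mem_starB η⁻¹ S₃
    (Ck ((↑(starB Xb) : Set (PBond P (i + k))).indicator (A - L⁻¹ ^ 2 • V))) hb₃
  have hHloc : Hloc (A - L⁻¹ ^ 2 • V) b = Hloc A b - L⁻¹ ^ 2 * Hloc V b := by
    rw [map_sub, map_smul, Pi.sub_apply, Pi.smul_apply, smul_eq_mul]
  have h11 := h5511_apply Dloc Dnext Hloc Cloc Hsloc h5511 (S (Qes f)) b
  -- the real identity of the two brackets at `b`
  have key :
      (((Tk (curl 1 ((↑(starB Xb) : Set (PBond P (i + k))).indicator (A - L⁻¹ ^ 2 • V))) b -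
                Dloc (S (curl 1 ((↑(starB Xb) : Set (PBond P (i + k))).indicator (A - L⁻¹ ^ 2 • V)))) b) +
              (Hk ((↑(starB Xb) : Set (PBond P (i + k))).indicator (A - L⁻¹ ^ 2 • V)) b - Hloc (A - L⁻¹ ^ 2 • V) b)) +
            Hloc (A - L⁻¹ ^ 2 • V) b) +
          grad η⁻¹ ((↑S₃ᶜ : Set (Balaban1983to89.Site P i)).indicator
            (Ck ((↑(starB Xb) : Set (PBond P (i + k))).indicator (A - L⁻¹ ^ 2 • V)))) b -
          L⁻¹ ^ 2 * Dloc (S (Qes f)) b =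
        Hloc A b - L⁻¹ ^ 2 * Dnext (S (Qes f)) b +
          ((Tk (curl 1 ((↑(starB Xb) : Set (PBond P (i + k))).indicator (A - L⁻¹ ^ 2 • V))) b -
              Dloc (S (curl 1 ((↑(starB Xb) : Set (PBond P (i + k))).indicator (A - L⁻¹ ^ 2 • V)))) b) +
            (Hk ((↑(starB Xb) : Set (PBond P (i + k))).indicator (A - L⁻¹ ^ 2 • V)) b - Hloc (A - L⁻¹ ^ 2 • V) b)) := by
    rw [hgrad, hHloc, hΛ₄]
    linear_combination (-(L⁻¹ ^ 2)) * h11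
  simp only [bgExp]
  rw [key]

/-! ## §3 *"In Λ₅^{(k)*} … "* — the hypothesis `hΛ₄` (`Λ₄^{(k)*}` acts as the identity at `b`) from range relations -/

/-- kernel: **printed order of (5.5.2)**, `V = Λ₄^{(k)*}·(C^{(k)}_{loc}H*_{k,loc}X_f)`: if `(H_{k,loc}B)(b)` depends only on the unit-lattice
bonds `near b` (a RANGE relation for `H_{k,loc}`, hypothesis `hH`) and every such bond lies in `Λ₄^{(k)*}` (*"b ∈ Λ₅^{(k)*}"* plus the collar,
hypothesis `hΛ`), then `(H_{k,loc}V)(b) = (H_{k,loc}C^{(k)}_{loc}H*_{k,loc}X_f)(b)` — gen 7's `apply_indicator_eq_of_range`.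
[cite: BalabanImbrieJaffe1988, (5.5.14) p.285] -/
theorem cutoff4_invisible_printed {m n : ℕ} (Hloc : (PBond P m → ℝ) →ₗ[ℝ] (PBond P n → ℝ)) (near : PBond P n → PBond P m → Prop)
    {b : PBond P n} (hH : ∀ B₁ B₂ : PBond P m → ℝ, (∀ c, near b c → B₁ c = B₂ c) → Hloc B₁ b = Hloc B₂ b)
    (Λ4s : Finset (PBond P m)) (hΛ : ∀ c, near b c → c ∈ Λ4s) (W : PBond P m → ℝ) :
    Hloc ((↑Λ4s : Set (PBond P m)).indicator W) b = Hloc W b :=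
  apply_indicator_eq_of_range (fun B b => Hloc B b) near hH Λ4s hΛ W

/-- kernel: **repaired order of (5.5.2)** (HOME/GAPS.md G-C2-08, reading (a)), `V = C^{(k)}_{loc}(Λ₄^{(k)*}·H*_{k,loc}X_f)`: if
`(H_{k,loc}C^{(k)}_{loc}B)(b)` depends only on the bonds `near b` (a range relation for the COMPOSITE, e.g. from those of `H_{k,loc}` and
`C^{(k)}_{loc}` by gen 7's `range_comp`) and every such bond lies in `Λ₄^{(k)*}`, then `(H_{k,loc}V)(b) = (H_{k,loc}C^{(k)}_{loc}H*_{k,loc}X_f)(b)`.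
[cite: BalabanImbrieJaffe1988, (5.5.14) p.285] -/
theorem cutoff4_invisible_repaired {m n : ℕ} (Hloc : (PBond P m → ℝ) →ₗ[ℝ] (PBond P n → ℝ))
    (Cloc : (PBond P m → ℝ) →ₗ[ℝ] (PBond P m → ℝ)) (near : PBond P n → PBond P m → Prop) {b : PBond P n}
    (hHC : ∀ B₁ B₂ : PBond P m → ℝ, (∀ c, near b c → B₁ c = B₂ c) → Hloc (Cloc B₁) b = Hloc (Cloc B₂) b)
    (Λ4s : Finset (PBond P m)) (hΛ : ∀ c, near b c → c ∈ Λ4s) (W : PBond P m → ℝ) :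
    Hloc (Cloc ((↑Λ4s : Set (PBond P m)).indicator W)) b = Hloc (Cloc W) b :=
  apply_indicator_eq_of_range (fun B b => Hloc (Cloc B) b) near hHC Λ4s hΛ W

/-- kernel: one lattice step has `ℓ^∞` length at most `1` (cf. the private twin in gen 7's `BIJ88Eq5410Torus`).
[cite: Balaban1982Higgs1, (1.3) p.604] -/
private theorem supDist_shift_le {n : ℕ} (x : Balaban1983to89.Site P n) (μ : Fin P.d) : supDist x (x.shift μ) ≤ 1 := by
  have h := supDist_runSite_le x μ 1
  have e : LatticeFieldCalculus.runSite x μ 1 = x.shift μ := by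
    simp [LatticeFieldCalculus.runSite, Balaban1983to89.Site.shift]
  rwa [e] at h

/-- **The collar geometry for BONDS, in the torus `ℓ^∞` distance** (the bond analogue of gen 7's `BIJ88Eq5410Torus.starP_of_collar`): if the
unit-lattice site set `X₄` (*"Λ₄^{(k)}"*) contains the cube of radius `N` about `x₀`, `x` lies in the cube of radius `N₀` about `x₀` (*"Λ₅^{(k)}"*,
p. 274: *"the sets Λ_α^{(j)} are determined by Λ_{α−1}^{(j)} by subtracting collar neighborhoods of width r(e_j)"*), and `N₀ + R + 1 ≤ N`, then
every bond within range `R` of `x` lies in `X₄* = Λ₄^{(k)*}` — the hypothesis `hΛ` of `cutoff4_invisible_printed`/`_repaired` for the range relation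
`|x − c₋|_∞ ≤ R`. [cite: BalabanImbrieJaffe1988, (5.5.14) p.285] -/
theorem starB_of_collar {n : ℕ} (X₄ : Finset (Balaban1983to89.Site P n)) (x₀ : Balaban1983to89.Site P n) {N N₀ R : ℕ}
    (hX₄ : ∀ y, supDist x₀ y ≤ N → y ∈ X₄) (hN : N₀ + R + 1 ≤ N) {x : Balaban1983to89.Site P n} (hx : supDist x₀ x ≤ N₀)
    {c : PBond P n} (hc : supDist x c.src ≤ R) : c ∈ starB X₄ := by
  rw [mem_starB]
  have h1 : supDist x₀ c.src ≤ N₀ + R := (supDist_triangle x₀ x c.src).trans (add_le_add hx hc)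
  refine ⟨hX₄ _ (by omega), hX₄ _ ?_⟩
  have h2 : supDist c.src c.tgt ≤ 1 := supDist_shift_le c.src c.dir
  have h3 := (supDist_triangle x₀ c.src c.tgt).trans (add_le_add h1 h2)
  omega

/-- **… hence, for an `H_{k,loc}` of `ℓ^∞` RANGE `R`** (`(H_{k,loc}B)(b)` depends only on the unit-lattice bonds `c` with `|x_b − c₋|_∞ ≤ R`, `x_b`
the unit-lattice point over `b`, hypothesis `hH`), the printed cut-off `Λ₄^{(k)*} = X₄*` is invisible at every `b` whose point `x_b` lies in the cube
of radius `N₀` when `X₄ ⊇` the cube of radius `N ≥ N₀ + R + 1` about the same centre: `(H_{k,loc}(Λ₄*·W))(b) = (H_{k,loc}W)(b)` — the hypothesis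
`hΛ₄` of `eq5514_torus` (printed order) discharged in metric form. [cite: BalabanImbrieJaffe1988, (5.5.14) p.285] -/
theorem cutoff4_invisible_supDist {m n : ℕ} (Hloc : (PBond P m → ℝ) →ₗ[ℝ] (PBond P n → ℝ)) (R : ℕ) (xb : PBond P n → Balaban1983to89.Site P m)
    (hH : ∀ (B₁ B₂ : PBond P m → ℝ) (b : PBond P n), (∀ c : PBond P m, supDist (xb b) c.src ≤ R → B₁ c = B₂ c) → Hloc B₁ b = Hloc B₂ b)
    (X₄ : Finset (Balaban1983to89.Site P m)) (x₀ : Balaban1983to89.Site P m) {N N₀ : ℕ} (hX₄ : ∀ y, supDist x₀ y ≤ N → y ∈ X₄)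
    (hN : N₀ + R + 1 ≤ N) {b : PBond P n} (hb : supDist x₀ (xb b) ≤ N₀) (W : PBond P m → ℝ) :
    Hloc ((↑(starB X₄) : Set (PBond P m)).indicator W) b = Hloc W b :=
  cutoff4_invisible_printed Hloc (fun b c => supDist (xb b) c.src ≤ R) (hH · · b) (starB X₄)
    (fun _ hc => starB_of_collar X₄ x₀ hX₄ hN hb hc) W

/-! ## §4 (5.6.1) and (5.6.6) on the torus; *"In Λ̄₆^{(k)*} … this reduces to the form in the induction hypothesis, (4.2)"* -/

/-- **(5.6.6) ∕ (5.6.1) ON THE TORUS.**  p. 285 [PDF 29]: *"ũ_{k+1} = (Q^{s*}_{k+1}v) exp ie_kη[(1 − θ_k)H_{k,loc}A^{(k)} − L^{−2}𝒟^η_{k+1,loc}∂*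
Q^{e*}_{k+1}f]. (5.6.1)"*; p. 287 [PDF 31]: *"ũ_{k+1}ũ = ũ_{k+1} exp ie_kη[θ_kH_{k,loc}A^{(k)} + w₁A′] = ũ_{k+1}e^{ie_kηÃ}. (5.6.6)"*  HERE, in the
setting of `eq5514_torus` and for ANY real η-bond function `θ_k`: with r16's `uTilde561 e_k η L (Q^{s*}_{k+1}v) θ_k (H_{k,loc}A^{(k)}) (𝒟^η_{k+1,loc}X_f)`
((5.6.1), `Q^{s*}_{k+1}v` = the concrete `qsstarGIter (k+1) v` read in `ℂ`) and `uSmall566 e_k η θ_k (H_{k,loc}A^{(k)}) (w₁A′)` ((5.6.6)'s `ũ`), the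
field (5.5.14) at `b` IS `ũ_{k+1}(b)·ũ(b)` (r16's `eq566` on the torus field; standing range). [cite: BalabanImbrieJaffe1988, (5.6.6) p.287] -/
theorem eq566_torus {k : ℕ} (hk : i + k + 1 ≤ P.m + P.K) {ek η : ℝ} (hη : η * (P.L : ℝ) ^ k = 1)
    (X : Finset (Balaban1983to89.Site P (i + k + 1))) {u' : GaugeField P (i + k) U1} (A V : PBond P (i + k) → ℝ) (L : ℝ)
    (hu : ∀ c ∈ starB (blockUnion 1 X), u' c = expU1 (ek * (A - L⁻¹ ^ 2 • V) c)) (v : GaugeField P (i + k + 1) U1) (g : PBond P i → ℝ)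
    {Plc : Type*} (Tk : (Balaban1983to89.Plaq P (i + k) → ℝ) →ₗ[ℝ] (PBond P i → ℝ))
    (Dloc Dnext : (PBond P i → ℝ) →ₗ[ℝ] (PBond P i → ℝ)) (S : (Balaban1983to89.Plaq P (i + k) → ℝ) →ₗ[ℝ] (PBond P i → ℝ))
    (Hk Hloc : (PBond P (i + k) → ℝ) →ₗ[ℝ] (PBond P i → ℝ)) (Ck : (PBond P (i + k) → ℝ) →ₗ[ℝ] (Balaban1983to89.Site P i → ℝ))
    (Cloc : (PBond P (i + k) → ℝ) →ₗ[ℝ] (PBond P (i + k) → ℝ)) (Hsloc : (PBond P i → ℝ) →ₗ[ℝ] (PBond P (i + k) → ℝ))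
    (h541 : ∀ (B : PBond P (i + k) → ℝ) (b : PBond P i),
      (torusBlockBondsIter P i k).Qsstar B b - Tk (curl 1 B) b = Hk B b + grad η⁻¹ (Ck B) b)
    (h5511 : Dloc + Hloc ∘ₗ Cloc ∘ₗ Hsloc = Dnext)
    (Qes : (Plc → ℝ) →ₗ[ℝ] (Balaban1983to89.Plaq P (i + k) → ℝ)) (f : Plc → ℝ)
    (Xb X₀ : Finset (Balaban1983to89.Site P (i + k))) (hX₀ : X₀ ⊆ Xb) (S₃ : Finset (Balaban1983to89.Site P i))
    {b : PBond P i} (hb₁ : b ∈ starB (blockUnion (k + 1) X)) (hb₀ : b ∈ starB (blockUnion k X₀)) (hb₃ : b ∈ starB S₃)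
    (hT : g b = Dloc (S (curl 1 (A - L⁻¹ ^ 2 • V) + L⁻¹ ^ 2 • Qes f)) b)
    (hdep : ∀ F₁ F₂ : Balaban1983to89.Plaq P (i + k) → ℝ, (∀ p ∈ starP Xb, F₁ p = F₂ p) → Dloc (S F₁) b = Dloc (S F₂) b)
    (hΛ₄ : Hloc V b = Hloc (Cloc (Hsloc (S (Qes f)))) b) (θ : PBond P i → ℝ) :
    bgGaugeU ek η ((↑S₃ : Set (Balaban1983to89.Site P i)).indicator
        (Ck ((↑(starB Xb) : Set (PBond P (i + k))).indicator (A - L⁻¹ ^ 2 • V))))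
        (backgroundU ek η (fun b => toC (qsstarGIter k (surfMul u' (cutoff (starB X) v)) b)) g) b =
      uTilde561 ek η L (fun b => toC (qsstarGIter (k + 1) v b)) θ (Hloc A) (Dnext (S (Qes f))) b *
        uSmall566 ek η θ (Hloc A)
          (fun b => (Tk (curl 1 ((↑(starB Xb) : Set (PBond P (i + k))).indicator (A - L⁻¹ ^ 2 • V))) b -
              Dloc (S (curl 1 ((↑(starB Xb) : Set (PBond P (i + k))).indicator (A - L⁻¹ ^ 2 • V)))) b) +
            (Hk ((↑(starB Xb) : Set (PBond P (i + k))).indicator (A - L⁻¹ ^ 2 • V)) b - Hloc (A - L⁻¹ ^ 2 • V) b)) b := by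
  rw [eq566, eq5514_torus hk hη X A V L hu v g Tk Dloc Dnext S Hk Hloc Ck Cloc Hsloc h541 h5511 Qes f Xb X₀ hX₀ S₃ hb₁ hb₀ hb₃ hT
    hdep hΛ₄]

/-- **"In Λ̄₆^{(k)*} the A^{(k)} term is absent, and except for scaling, this reduces to the form in the induction hypothesis, (4.2)"** (p. 286
[PDF 30]) ON THE TORUS: for `θ_k` with the two printed support clauses (r16's `IsTheta561 Λ̄₆* Λ̄₅* θ_k`) and `b ∈ Λ̄₆^{(k)*}`, the field (5.6.1)
`ũ_{k+1}` with the concrete prefactor `Q^{s*}_{k+1}v = qsstarGIter (k+1) v` IS r18's (4.2) `backgroundU e_k η (Q^{s*}_{k+1}v) g′` with `g′ =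
L^{−2}𝒟^η_{k+1,loc}X_f` — the induction-hypothesis form with the new block field pulled back `k+1` times (the scaling to `T^{(k+1)}_1`, (5.15.3),
is not performed). [cite: BalabanImbrieJaffe1988, (5.6.1) p.286] -/
theorem uTilde561_eq_backgroundU_of_mem {k : ℕ} (ek η L : ℝ) (v : GaugeField P (i + k + 1) U1)
    {Λ6s Λ5s : Set (PBond P i)} {θ : PBond P i → ℝ} (hθ : IsTheta561 Λ6s Λ5s θ) (HA DXf : PBond P i → ℝ) {b : PBond P i}
    (hb : b ∈ Λ6s) :
    uTilde561 ek η L (fun b => toC (qsstarGIter (k + 1) v b)) θ HA DXf b =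
      backgroundU ek η (fun b => toC (qsstarGIter (k + 1) v b)) (fun b => L⁻¹ ^ 2 * DXf b) b :=
  uTilde561_of_theta_eq_one ek η L _ HA DXf (hθ.1 b hb)

/-- kernel, the p. 286 summary's middle region: *"the final form of ũ_{k+1} is given … by (5.5.13) in Λ̄₃^{(k)c*c} ∩ Λ̄₅^{(k)*c} (but without
the w₁ terms), and by (5.6.1) in Λ̄₅^{(k)*}"* — OFF `Λ̄₅^{(k)*}`, where `θ_k = 0` (second support clause of `IsTheta561`), the formula (5.6.1)
carries the FULL term `H_{k,loc}A^{(k)}`: `ũ_{k+1}(b) = (Q^{s*}_{k+1}v)(b) exp ie_kη[H_{k,loc}A^{(k)} − L^{−2}𝒟^η_{k+1,loc}X_f](b)`, i.e. (5.5.14)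
without `w₁A′` (r16's `bgExp`). [cite: BalabanImbrieJaffe1988, (5.6.1) p.286] -/
theorem uTilde561_eq_of_not_mem {B : Type*} (ek η L : ℝ) (Q : B → ℂ) {Λ6s Λ5s : Set B} {θ : B → ℝ} (hθ : IsTheta561 Λ6s Λ5s θ)
    (HA DXf : B → ℝ) {b : B} (hb : b ∉ Λ5s) :
    uTilde561 ek η L Q θ HA DXf b = bgExp ek η Q (fun b => HA b - L⁻¹ ^ 2 * DXf b) b := by
  simp only [uTilde561, bgExp, bracket561, hθ.2 b hb, sub_zero, one_mul]

end

end Literature.MathematicalPhysics.QuantumFieldTheory.BalabanImbrieJaffe1984to88.BIJ88Eq5514Torus
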